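import Summits.CriticalPhenomena.PercolationContinuityZ3.Theorems.PercNearOneGluingNoHeavyLowerTailSahiGridPatternTopCube
import Summits.CriticalPhenomena.PercolationContinuityZ3.Theorems.PercNearOneGluingNoHeavyLowerTailSahiGridPatternDiagCert

/-!
# `NoHeavyLowerTail` (crux stmt-CriticalPhenomena-4575), Sahi programme P1: **TOP-CUBE SLOTS ARE GOOD IN EVERY DIMENSION** —
# the trivial diagonal certificate of every top-cube up-set, and the cylinders `U × [3]^n`

Support file (Sahi cell, seat `prim-sahi-p1`, generation 19; `--supports stmt-CriticalPhenomena-4575`).  Pure proofs, NO definitions,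
no `sorry`, standard axioms.  Vocabulary of `…SahiGridPattern{TopCube,DiagCert,CellForm,RectCert}` (`cylSet U = U × [3]^n`, `lamU`,
`thetaVal`, `fromSet`).

THE MATHEMATICS.  Generation 19's theorem `sStarD_topCube_ge_harris` (`sStarD U B C ≥ H(U,B∩C)` for every up-set `U ⊆ [3]^k` inside
the top cube `{1,2}^k` and all up-sets `B, C`) says, in the certificate language of generation 16 (`…DiagCert`), that the TRIVIAL
diagonal vector `d = 2^k·1_U` satisfies condition (N) `Θ_U(A×A′) ≤ d(A∩A′)` (**`diagCert_N_of_topCube`**); condition (T) holds for the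
trivial vector of every up-set (`diagCert_T_of_trivial`, coefficientwise Harris).  Hence (`sStarD_cylSet_nonneg_of_diagCert`)
**`sStarD_cylSet_topCube_nonneg`**: for every `k`, every top-cube up-set `U ⊆ [3]^k` and every `n`, the junta cylinder `U × [3]^n` is a
GOOD SLOT of the pattern functional in dimension `n + k`: `0 ≤ sStarD (U × [3]^n) B C` for all up-sets `B, C ⊆ [3]^{n+k}`.  This is a
Boolean algebra's worth of new every-dimension slots `{x : x|_J ≥ 1^J, twos(x|_J) ∈ 𝒰}` (`J` a set of `k` axes, `𝒰 ⊆ 2^J` any up-family),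
beyond the juntas of `≤ 3` coordinates (generation 11) and the orthants / co-orthants (generation 9): e.g. the threshold slots
`{x : x|_J ≥ 1, #twos(x|_J) ≥ j}` (**`sStarD_cylSet_twosThreshold_nonneg`**, via `isUpperSet_twosFamily`).  This is a statement about
the pattern functional (one family of coefficients of Sahi's cubic `Z³·E₃` under Latin-hypercube sampling); NO value-level corollary for
general grids is claimed here (pull-backs of top-cube slots along sorted triples are two-threshold slots `{x ≥ s : {a : x_a ≥ t_a} ∈ 𝒰}`,
which are not covered).  Nothing here asserts `PatternPos d` for any `d ≥ 4`. [this work]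
-/

namespace Summit.CriticalPhenomena.PercolationContinuityZ3.Theorems.SahiGridPattern

open Finset SahiGrid3
open scoped BigOperators

variable {n k : ℕ}

/-- **Counting form** of the top-cube theorem: `2^k·#(U ∩ B ∩ C) ≤ sStarD U B C + #{(x,y) ∈ U × (B∩C) : x δ̸ y}`. [this work] -/
theorem sStarD_topCube_ge_harris_card (U : Finset (Pd k)) (hU : IsUpperSet (U : Set (Pd k))) (htop : ∀ u ∈ U, ∀ a, u a ≠ 0)
    {B C : Finset (Pd k)} (hB : IsUpperSet (B : Set (Pd k))) (hC : IsUpperSet (C : Set (Pd k))) :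
    2 ^ k * ((U ∩ (B ∩ C)).card : ℤ) ≤
      sStarD U B C + (((U ×ˢ (B ∩ C)).filter fun xy => TotDist xy.1 xy.2 = true).card : ℤ) := by
  have h := sStarD_topCube_ge_harris U hU htop B C hB hC
  have hBC : ∀ y, ind B y * ind C y = ind (B ∩ C) y := fun y => (ind_inter_eq_mul B C y).symm
  have e1 : (∑ x, ind U x * ind B x * ind C x) = ((U ∩ (B ∩ C)).card : ℤ) := by
    rw [← sum_ind_mul_ind_eq_card]
    exact Finset.sum_congr rfl fun x _ => by rw [mul_assoc, hBC]
  have e2 : (∑ x, ∑ y, ind U x * ind B y * ind C y * (if TotDist x y = true then (1:ℤ) else 0)) =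
      ((((U ×ˢ (B ∩ C))).filter fun xy => TotDist xy.1 xy.2 = true).card : ℤ) := by
    rw [← sum_sum_ind_totDist_eq_card]
    exact Finset.sum_congr rfl fun x _ => Finset.sum_congr rfl fun y _ => by rw [mul_assoc (ind _ x), hBC]
  rw [← e1, ← e2]; exact h

/-- **Condition (N) for the TRIVIAL diagonal certificate `d = 2^k·1_U` of every TOP-CUBE up-set `U`** (every `k`):
`Θ_U(A×A′) ≤ Σ_{q ∈ A∩A′} 2^k·1_U(q)` for all up-sets `A, A′` — generation 16's `(†_diag)_k(U)` holds with the trivial vector for every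
up-set inside the top cube `{1,2}^k` (census: 20/20 at `k = 3`, exhaustive `k ≤ 5`; here for all `k`). [this work] -/
theorem diagCert_N_of_topCube (U : Finset (Pd k)) (hU : IsUpperSet (U : Set (Pd k))) (htop : ∀ u ∈ U, ∀ a, u a ≠ 0)
    (A A' : Finset (Pd k)) (hA : IsUpperSet (A : Set (Pd k))) (hA' : IsUpperSet (A' : Set (Pd k))) :
    (∑ q ∈ A, ∑ r ∈ A', thetaVal U q r) ≤ ∑ q ∈ A ∩ A', (2 : ℤ) ^ k * ind U q := by
  have hS := sStarD_eq_sum_lamU_sub_sum_thetaVal U A A'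
  have h := sStarD_topCube_ge_harris_card U hU htop hA hA'
  have hnu : (∑ q ∈ A ∩ A', (nuCount U q : ℤ)) = (((U ×ˢ (A ∩ A')).filter fun pq => TotDist pq.1 pq.2 = true).card : ℤ) := by
    unfold nuCount
    rw [Finset.card_filter, Nat.cast_sum, Finset.sum_product, Finset.sum_comm]
    refine Finset.sum_congr rfl fun q _ => ?_
    rw [Finset.card_filter, Nat.cast_sum]
  have hind : (∑ q ∈ A ∩ A', ind U q) = ((U ∩ (A ∩ A')).card : ℤ) := by
    unfold ind
    rw [Finset.sum_boole, Finset.filter_mem_eq_inter, Finset.inter_comm]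
  have hlam : (∑ q ∈ A ∩ A', lamU U q) = 2 * 2 ^ k * (∑ q ∈ A ∩ A', ind U q) - ∑ q ∈ A ∩ A', (nuCount U q : ℤ) := by
    unfold lamU
    rw [Finset.sum_sub_distrib, ← Finset.mul_sum]
  rw [← Finset.mul_sum, hind]
  rw [hlam, hnu, hind] at hS
  linarith

/-- **EVERY TOP-CUBE SLOT IS GOOD IN EVERY DIMENSION**: for an up-set `U ⊆ [3]^k` inside the top cube `{1,2}^k` and every `n`, the
cylinder `U × [3]^n` satisfies `0 ≤ sStarD (U × [3]^n) B C` for all up-sets `B, C ⊆ [3]^{n+k}` (the diagonal certificate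
`d = 2^k·1_U`: (T) by coefficientwise Harris, (N) by `diagCert_N_of_topCube`). [this work] -/
theorem sStarD_cylSet_topCube_nonneg (U : Finset (Pd k)) (hU : IsUpperSet (U : Set (Pd k))) (htop : ∀ u ∈ U, ∀ a, u a ≠ 0)
    {B C : Finset (Pd (n + k))} (hB : IsUpperSet (B : Set (Pd (n + k)))) (hC : IsUpperSet (C : Set (Pd (n + k)))) :
    0 ≤ sStarD (cylSet U : Finset (Pd (n + k))) B C :=
  sStarD_cylSet_nonneg_of_diagCert U (fun q => (2 : ℤ) ^ k * ind U q)
    (fun q => mul_nonneg (pow_nonneg (by norm_num) k) (ind_nonneg' U q))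
    (fun W hW => diagCert_T_of_trivial U W hU hW) (fun A A' hA hA' => diagCert_N_of_topCube U hU htop A A' hA hA') hB hC

/-! ### The Boolean algebra of top-cube slots: `{x ≥ 1^k : twos(x) ∈ 𝒰}` -/

/-- On `Fin 3`: a nonzero value below another forces the other to be nonzero, and `2` below another forces `2` (bookkeeping). [this work] -/
theorem fin3_order_facts : (∀ v w : Fin 3, v ≠ 0 → v ≤ w → w ≠ 0) ∧ (∀ v w : Fin 3, v = 2 → v ≤ w → w = 2) := by
  refine ⟨?_, ?_⟩ <;> decide

/-- **The slot of an up-family of the top cube is an up-set of `[3]^k`**: for an upper family `𝒰 ⊆ 2^[k]`,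
`{x ∈ [3]^k : ∀ a, x_a ≠ 0, and twos(x) ∈ 𝒰}` is an up-set (inside the top cube by definition). [this work] -/
theorem isUpperSet_twosFamily (𝒰 : Finset (Finset (Fin k))) (h𝒰 : IsUpperSet (𝒰 : Set (Finset (Fin k)))) :
    IsUpperSet ((univ.filter fun x : Pd k => (∀ a, x a ≠ 0) ∧ (univ.filter fun a => x a = 2) ∈ 𝒰 : Finset (Pd k)) : Set (Pd k)) := by
  intro x y hxy hx
  rw [Finset.mem_coe, Finset.mem_filter] at hx ⊢
  refine ⟨mem_univ _, fun a => fin3_order_facts.1 (x a) (y a) (hx.2.1 a) (hxy a), h𝒰 ?_ hx.2.2⟩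
  intro a ha
  rw [Finset.mem_filter] at ha ⊢
  exact ⟨mem_univ _, fin3_order_facts.2 (x a) (y a) ha.2 (hxy a)⟩

/-- **Every top-cube slot `{x ≥ 1^k : twos(x) ∈ 𝒰}` (𝒰 an up-family) is good in every dimension**: its cylinder over `[3]^n` has
`0 ≤ sStarD (U × [3]^n) B C` for all up-sets `B, C`. [this work] -/
theorem sStarD_cylSet_twosFamily_nonneg (𝒰 : Finset (Finset (Fin k))) (h𝒰 : IsUpperSet (𝒰 : Set (Finset (Fin k))))
    {B C : Finset (Pd (n + k))} (hB : IsUpperSet (B : Set (Pd (n + k)))) (hC : IsUpperSet (C : Set (Pd (n + k)))) :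
    0 ≤ sStarD (cylSet (univ.filter fun x : Pd k => (∀ a, x a ≠ 0) ∧ (univ.filter fun a => x a = 2) ∈ 𝒰) : Finset (Pd (n + k))) B C :=
  sStarD_cylSet_topCube_nonneg _ (isUpperSet_twosFamily 𝒰 h𝒰)
    (fun u hu => by rw [Finset.mem_filter] at hu; exact hu.2.1) hB hC

/-- The threshold family `{S : j ≤ #S}` is an upper family. [this work] -/
theorem isUpperSet_cardThreshold (j : ℕ) :
    IsUpperSet ((univ.filter fun S : Finset (Fin k) => j ≤ S.card : Finset (Finset (Fin k))) : Set (Finset (Fin k))) := by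
  intro S S' hSS' hS
  rw [Finset.mem_coe, Finset.mem_filter] at hS ⊢
  exact ⟨mem_univ _, hS.2.trans (Finset.card_le_card hSS')⟩

/-- **The threshold slots `{x ≥ 1^k : #twos(x) ≥ j}` are good in every dimension** (`j = 0`: the orthant `↑1^k`; `j = k`: the orthant
`↑2^k`; `0 < j < k`: new, non-principal slots). [this work] -/
theorem sStarD_cylSet_twosThreshold_nonneg (j : ℕ) {B C : Finset (Pd (n + k))} (hB : IsUpperSet (B : Set (Pd (n + k))))
    (hC : IsUpperSet (C : Set (Pd (n + k)))) :
    0 ≤ sStarD (cylSet (univ.filter fun x : Pd k => (∀ a, x a ≠ 0) ∧ j ≤ (univ.filter fun a => x a = 2).card) : Finset (Pd (n + k))) B C := by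
  have e : (univ.filter fun x : Pd k => (∀ a, x a ≠ 0) ∧ j ≤ (univ.filter fun a => x a = 2).card)
      = univ.filter fun x : Pd k => (∀ a, x a ≠ 0) ∧ (univ.filter fun a => x a = 2) ∈
          (univ.filter fun S : Finset (Fin k) => j ≤ S.card) := by
    ext x; simp only [Finset.mem_filter, Finset.mem_univ, true_and]
  rw [e]
  exact sStarD_cylSet_twosFamily_nonneg _ (isUpperSet_cardThreshold j) hB hC

/-- The dimension-`k` instance (no cylinder): every top-cube slot `{x ≥ 1^k : twos(x) ∈ 𝒰}` is a good slot of `PatternPos k`'s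
functional, `0 ≤ sStarD U B C`. [this work] -/
theorem sStarD_twosFamily_nonneg (𝒰 : Finset (Finset (Fin k))) (h𝒰 : IsUpperSet (𝒰 : Set (Finset (Fin k))))
    {B C : Finset (Pd k)} (hB : IsUpperSet (B : Set (Pd k))) (hC : IsUpperSet (C : Set (Pd k))) :
    0 ≤ sStarD (univ.filter fun x : Pd k => (∀ a, x a ≠ 0) ∧ (univ.filter fun a => x a = 2) ∈ 𝒰) B C :=
  sStarD_topCube_nonneg _ (isUpperSet_twosFamily 𝒰 h𝒰) (fun u hu => by rw [Finset.mem_filter] at hu; exact hu.2.1) hB hC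

end Summit.CriticalPhenomena.PercolationContinuityZ3.Theorems.SahiGridPattern
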